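import Literature.MathematicalPhysics.QuantumFieldTheory.BalabanImbrieJaffe1984to88.BIJ88TruncatedExpectation5142Slots
import Literature.MathematicalPhysics.QuantumFieldTheory.BalabanImbrieJaffe1984to88.BIJ88Expansion5143Gauss

/-!
# `BalabanImbrieJaffe1984to88.BIJ88SlotLeibniz308` — [BalabanImbrieJaffe1988] CMP **114** (1988), Sect. 5.14 p. 308 [PDF 52]:
**«We express each d/dt as a sum Σ_γ (d/dt)_γ»** — Leibniz over slot ASSIGNMENTS for factors smooth on an OPEN SET (the branch
`0 < t`, `te_k < 1` of the p. 308 family, where the χ-factors `χ(c p(te_k), ·)` live), in the label-subset / pinned-assignment form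
`asg s₀ K` of `BIJ88TruncatedExpectation5142Slots`; and **slot-locality of the display-2 truncated functions from slot-locality of the
moments** (the hypothesis `hκloc` of `…5142Slots.sum_asg_trunc_eq_iteratedDerivWithin_log` DISCHARGED).

statement-level skeleton of published theorems with citation tags; proofs where landed; nothing here is a claim about the Yang–Mills mass gap

THE PRINT (verbatim, p. 308 [PDF 52]; image `lit-balaban-r16/renders/cmp114/original-p052-x2.png`, text layer re-read this session):
*"Here ⟨·⟩_t is the interacting expectation ⟨·⟩_t = (1/z_t(Λ₁₂^{(k)})) ⟨· χ′_{Λ₁₂^{(k)},t} e^{−tṼ^{(k)}(Λ^{(k)}_{12})}⟩_{1,Λ₁₂^{(k)}}, with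
χ′_{Λ₁₂^{(k)},t} defined as above replacing p(e_k) with p(te_k). We express each d/dt as a sum Σ_γ (d/dt)_γ, where (d/dt)_γ acts only on
the t before a particular term V^{(k)}(Y) in Ṽ^{(k)} or in a particular χ-factor. We cluster expand as before each integral making up the
truncated expectation values ⟨(d/dt)_{γ_1}; …; (d/dt)_{γ_{n̄+1}}⟩_t."*

RELATION TO THE TREE.  p25's `BIJ88Expansion5143Gauss.iteratedDeriv_prod_eq_sum_assignments` is the same device for factors ALL of whose
iterated derivatives are differentiable on the whole line, labels `Fin n`, multiplicities `BIJ88Expansion5143Gauss.mult`.  The χ-factors of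
the p. 308 family are smooth only on the open branch (the logarithm `p(te_k) = (log (te_k)⁻¹)^p`), and `…5142Slots` sums over the pinned
assignments `asg s₀ K` of a label SUBSET `K ⊆ H`; hence the present local / `asg` form (`sum_asg_prod_iteratedDeriv`), from which the
`Fin n`/`mult` shape on an open set follows (`iteratedDeriv_prod_eq_sum_mult_of_isOpen`).  Nothing of p25's file is restated.

WHAT IS PROVED (theorems only; no `def`, no `Prop` fact).
* §1 `sum_asg_insert` (one more free label: `Σ_{asg (insert j₀ K)} = Σ_{asg K} Σ_σ ∘ update j₀ σ`), `card_filter_insert_update` (the slot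
  counts of the updated assignment), `prod_succ_count_eq` (bookkeeping of one extra derivative on the term `σ`).
* §2 `hasDerivAt_iteratedDeriv_of_isOpen`; **`sum_asg_prod_iteratedDeriv`**: for a finite family `f τ` (`τ ∈ S`) of functions `C^{|K|}` on an
  open set `U ∋ x` (any nontrivially normed field, values in a normed commutative algebra),
  `Σ_{γ ∈ asg s₀ K} Π_τ f_τ^{(#{j ∈ K : γ j = τ})}(x) = (Π_τ f_τ)^{(|K|)}(x)`; all labels: `sum_prod_iteratedDeriv_eq`; p25's shape on an
  open set: `iteratedDeriv_prod_eq_sum_mult_of_isOpen`.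
* §3 **`trunc_local_of_moment_local`**: if the slot moments `N(K,γ)` depend on `γ` only through `γ|_K` (`K ⊆ H`) and `κ(·,γ)` solves p. 310
  display 2 against `N(·,γ)` for every assignment `γ`, then `κ(A,γ)` depends on `γ` only through `γ|_A` (`∅ ≠ A ⊆ H`) — by the uniqueness
  of the truncated functions (`BIJ88TruncatedExpectation5142.trunc_unique`); whence `sum_asg_trunc_rel_of_moment_local` and
  **`sum_asg_trunc_eq_iteratedDerivWithin_log_of_moment_local`** = `…5142Slots.sum_asg_trunc_eq_iteratedDerivWithin_log` with its
  hypothesis `hκloc` replaced by locality of the MOMENTS (which the concrete moments `⟨Π_{j∈K}(d/dt)_{γ_j}⟩_t` visibly have — sequel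
  `BIJ88SlotMoments308`).

HONEST SCOPE.  Pure calculus / finite algebra; the p. 308 family (slot factors, `z_t`, the moments under the integral sign) is the sequel
`BIJ88SlotMoments308`.  0 `sorry`; axioms standard.

CITATION HEADER (lean-in-tree rule).  lit-balaban TYPED SKELETON (HOME `run/shared/lean/pub/lit-balaban/`), Phase 2, seat p36 gen 10
(unit `lit-balaban-p36`); rows **C2.Eq5.14.1-5.14.2** ((5.14.2)) and **C2.Claim@310** (display 2) of `HOME/lit-balaban-r16/ROWS-C2-part2.md`
(owner r16; heads untouched; p25's and gen-9's decls used BY NAME).  PDF held: `paper:balaban1988-cmp114-bij-abelian-higgs-effective-action`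
(journal page = PDF page + 256).  NOT summit progress.
-/

open Finset
open scoped Topology
open Literature.Probability.LatticeModels (IsSetPartition setPartitions mem_setPartitions)
open Literature.MathematicalPhysics.QuantumFieldTheory.BalabanImbrieJaffe1984to88.BIJ88TruncatedExpectation5142

namespace Literature.MathematicalPhysics.QuantumFieldTheory.BalabanImbrieJaffe1984to88.BIJ88SlotLeibniz308

/-! ## §1 Assignments with one more free label; slot counts -/

section Combinatorics

variable {α : Type*} [Fintype α] [DecidableEq α] {S : Type*} [Fintype S] [DecidableEq S]

omit [DecidableEq S] in
/-- **One more free label.** For `j₀ ∉ K`, summing over the assignments of the labels of `insert j₀ K` is summing over those of `K` and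
over the slot `σ` given to `j₀`: `Σ_{γ ∈ asg (insert j₀ K)} Φ γ = Σ_{γ ∈ asg K} Σ_σ Φ (update γ j₀ σ)` (*"We express each d/dt as a sum
Σ_γ (d/dt)_γ"* — one `d/dt` at a time). [cite: BalabanImbrieJaffe1988, (5.14.2) p.308] -/
theorem sum_asg_insert {M : Type*} [AddCommMonoid M] (s₀ : S) {K : Finset α} {j₀ : α} (hj₀ : j₀ ∉ K)
    (Φ : (α → S) → M) :
    ∑ γ ∈ asg s₀ (insert j₀ K), Φ γ = ∑ γ ∈ asg s₀ K, ∑ σ : S, Φ (Function.update γ j₀ σ) := by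
  rw [← sum_product' (s := asg s₀ K) (t := (univ : Finset S)) (f := fun γ σ => Φ (Function.update γ j₀ σ))]
  symm
  refine sum_nbij' (fun q => Function.update q.1 j₀ q.2) (fun γ => (Function.update γ j₀ s₀, γ j₀)) ?_ ?_ ?_ ?_
    (fun _ _ => rfl)
  · rintro ⟨γ, σ⟩ hq
    have hγ : γ ∈ asg s₀ K := (mem_product.1 hq).1
    refine mem_asg.2 fun j hj => ?_
    rw [mem_insert, not_or] at hj
    show Function.update γ j₀ σ j = s₀
    rw [Function.update_of_ne hj.1]
    exact mem_asg.1 hγ j hj.2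
  · intro γ hγ
    refine mem_product.2 ⟨mem_asg.2 fun j hj => ?_, mem_univ _⟩
    show Function.update γ j₀ s₀ j = s₀
    by_cases h : j = j₀
    · rw [h, Function.update_self]
    · rw [Function.update_of_ne h]
      exact mem_asg.1 hγ j (by rw [mem_insert, not_or]; exact ⟨h, hj⟩)
  · rintro ⟨γ, σ⟩ hq
    have hγ : γ ∈ asg s₀ K := (mem_product.1 hq).1
    refine Prod.ext ?_ ?_
    · funext j
      show Function.update (Function.update γ j₀ σ) j₀ s₀ j = γ j
      by_cases h : j = j₀
      · rw [h, Function.update_self]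
        exact (mem_asg.1 hγ j₀ hj₀).symm
      · rw [Function.update_of_ne h, Function.update_of_ne h]
    · show Function.update γ j₀ σ j₀ = σ
      exact Function.update_self ..
  · intro γ _
    funext j
    show Function.update (Function.update γ j₀ s₀) j₀ (γ j₀) j = γ j
    by_cases h : j = j₀
    · rw [h, Function.update_self]
    · rw [Function.update_of_ne h, Function.update_of_ne h]

omit [Fintype α] [Fintype S] in
/-- The slot counts of the updated assignment: the labels of `insert j₀ K` sent to `τ` by `update γ j₀ σ` are those of `K` sent to `τ` by
`γ`, plus one if `σ = τ`. [cite: BalabanImbrieJaffe1988, (5.14.2) p.308] -/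
theorem card_filter_insert_update {K : Finset α} {j₀ : α} (hj₀ : j₀ ∉ K) (γ : α → S) (σ τ : S) :
    ((insert j₀ K).filter fun j => Function.update γ j₀ σ j = τ).card =
      (K.filter fun j => γ j = τ).card + if σ = τ then 1 else 0 := by
  rw [filter_insert, Function.update_self]
  have hK : (K.filter fun j => Function.update γ j₀ σ j = τ) = K.filter fun j => γ j = τ := by
    refine filter_congr fun j hj => ?_
    rw [Function.update_of_ne (fun h' => hj₀ (by rwa [h'] at hj))]
  by_cases h : σ = τ
  · rw [if_pos h, if_pos h, hK, card_insert_of_notMem (fun h' => hj₀ (mem_filter.1 h').1)]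
  · rw [if_neg h, if_neg h, hK, add_zero]

omit [Fintype α] [DecidableEq α] in
/-- One extra derivative on the term `σ`: `Π_τ g_τ(m_τ + [σ = τ]) = (Π_{τ ≠ σ} g_τ(m_τ)) · g_σ(m_σ + 1)`.
[cite: BalabanImbrieJaffe1988, (5.14.2) p.308] -/
theorem prod_succ_count_eq {N : Type*} [CommMonoid N] (g : S → ℕ → N) (m : S → ℕ) (σ : S) :
    ∏ τ, g τ (m τ + if σ = τ then 1 else 0) = (∏ τ ∈ univ.erase σ, g τ (m τ)) * g σ (m σ + 1) := by
  rw [← prod_erase_mul univ _ (mem_univ σ), if_pos rfl]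
  congr 1
  exact prod_congr rfl fun τ hτ => by rw [if_neg (ne_of_mem_erase hτ).symm, add_zero]

end Combinatorics

/-! ## §2 `d/dt = Σ_γ (d/dt)_γ`, iterated, for factors smooth on an open set -/

section Calculus

variable {𝕜 : Type*} [NontriviallyNormedField 𝕜] {𝔸 : Type*} [NormedCommRing 𝔸] [NormedAlgebra 𝕜 𝔸]

/-- On an open set where `f` is `C^{m+1}`, the `m`-th derivative has derivative the `(m+1)`-st. [cite: BalabanImbrieJaffe1988, (5.14.2) p.308] -/
theorem hasDerivAt_iteratedDeriv_of_isOpen {U : Set 𝕜} (hU : IsOpen U) {f : 𝕜 → 𝔸} {m : ℕ}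
    (hf : ContDiffOn 𝕜 (m + 1 : ℕ) f U) {x : 𝕜} (hx : x ∈ U) :
    HasDerivAt (iteratedDeriv m f) (iteratedDeriv (m + 1) f x) x := by
  have hdiffW : DifferentiableOn 𝕜 (iteratedDerivWithin m f U) U :=
    hf.differentiableOn_iteratedDerivWithin (by exact_mod_cast Nat.lt_succ_self m) hU.uniqueDiffOn
  have hev : iteratedDerivWithin m f U =ᶠ[𝓝 x] iteratedDeriv m f := by
    filter_upwards [hU.mem_nhds hx] with s hs
    exact iteratedDerivWithin_of_isOpen hU hs
  have hda : DifferentiableAt 𝕜 (iteratedDeriv m f) x :=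
    ((hdiffW x hx).differentiableAt (hU.mem_nhds hx)).congr_of_eventuallyEq hev.symm
  rw [iteratedDeriv_succ]
  exact hda.hasDerivAt

variable {α : Type*} [Fintype α] [DecidableEq α] {S : Type*} [Fintype S] [DecidableEq S]

/-- **`d/dt = Σ_γ (d/dt)_γ`, ITERATED OVER THE LABELS OF `K`, FOR FACTORS SMOOTH ON AN OPEN SET** (p. 308: *"We express each d/dt as a sum
Σ_γ (d/dt)_γ, where (d/dt)_γ acts only on the t before a particular term V^{(k)}(Y) in Ṽ^{(k)} or in a particular χ-factor"*): for a
finite family of factors `f τ`, `τ ∈ S`, of class `C^{|K|}` on an open set `U ∋ x`, summing over the assignments `γ` of the labels of `K` to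
the terms (pinned to `s₀` off `K`, `…5142Slots.asg`) the products of the factors, each differentiated as many times as `K` assigns labels to
it, gives the `|K|`-th derivative of the product: `Σ_{γ ∈ asg s₀ K} Π_τ f_τ^{(#{j ∈ K : γ j = τ})}(x) = (Π_τ f_τ)^{(|K|)}(x)` (induction on
`K`: one more label = one more `d/dt`, distributed over the terms by the product rule). [cite: BalabanImbrieJaffe1988, (5.14.2) p.308] -/
theorem sum_asg_prod_iteratedDeriv (s₀ : S) {U : Set 𝕜} (hU : IsOpen U) {f : S → 𝕜 → 𝔸} (K : Finset α)
    (hf : ∀ τ, ContDiffOn 𝕜 (K.card : ℕ) (f τ) U) {x : 𝕜} (hx : x ∈ U) :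
    ∑ γ ∈ asg s₀ K, ∏ τ, iteratedDeriv ((K.filter fun j => γ j = τ).card) (f τ) x =
      iteratedDeriv K.card (fun s => ∏ τ, f τ s) x := by
  induction K using Finset.induction_on generalizing x with
  | empty =>
    simp [asg_empty]
  | insert j₀ K hj₀ ih =>
    rw [card_insert_of_notMem hj₀] at hf ⊢
    -- the right side: differentiate the order-`|K|` identity, valid on the neighbourhood `U` of `x`
    have hfK : ∀ τ, ContDiffOn 𝕜 (K.card : ℕ) (f τ) U := fun τ =>
      (hf τ).of_le (by exact_mod_cast Nat.le_succ _)
    have hev : iteratedDeriv K.card (fun s => ∏ τ, f τ s) =ᶠ[𝓝 x]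
        fun y => ∑ γ ∈ asg s₀ K, ∏ τ, iteratedDeriv ((K.filter fun j => γ j = τ).card) (f τ) y := by
      filter_upwards [hU.mem_nhds hx] with y hy
      exact (ih hfK hy).symm
    rw [iteratedDeriv_succ, hev.deriv_eq]
    -- each summand is a finite product of differentiable functions
    have hcard : ∀ (γ : α → S) τ, (K.filter fun j => γ j = τ).card ≤ K.card := fun γ τ => card_filter_le _ _
    have hder : ∀ (γ : α → S) τ, HasDerivAt (iteratedDeriv ((K.filter fun j => γ j = τ).card) (f τ))
        (iteratedDeriv ((K.filter fun j => γ j = τ).card + 1) (f τ) x) x := fun γ τ =>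
      hasDerivAt_iteratedDeriv_of_isOpen hU ((hf τ).of_le (by exact_mod_cast Nat.succ_le_succ (hcard γ τ))) hx
    have hsum : HasDerivAt (fun y => ∑ γ ∈ asg s₀ K, ∏ τ, iteratedDeriv ((K.filter fun j => γ j = τ).card) (f τ) y)
        (∑ γ ∈ asg s₀ K, ∑ σ, (∏ τ ∈ univ.erase σ, iteratedDeriv ((K.filter fun j => γ j = τ).card) (f τ) x) •
          iteratedDeriv ((K.filter fun j => γ j = σ).card + 1) (f σ) x) x :=
      HasDerivAt.fun_sum fun γ _ => HasDerivAt.fun_finsetProd fun τ _ => hder γ τ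
    rw [hsum.deriv, sum_asg_insert s₀ hj₀]
    refine sum_congr rfl fun γ _ => sum_congr rfl fun σ _ => ?_
    simp only [card_filter_insert_update hj₀, smul_eq_mul]
    exact prod_succ_count_eq (fun τ m => iteratedDeriv m (f τ) x) _ σ

/-- **All labels, all assignments**: `Σ_{γ : α → S} Π_τ f_τ^{(#{j : γ j = τ})}(x) = (Π_τ f_τ)^{(|α|)}(x)` for factors `C^{|α|}` on an open
`U ∋ x`. [cite: BalabanImbrieJaffe1988, (5.14.2) p.308] -/
theorem sum_prod_iteratedDeriv_eq [Nonempty S] {U : Set 𝕜} (hU : IsOpen U) {f : S → 𝕜 → 𝔸}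
    (hf : ∀ τ, ContDiffOn 𝕜 (Fintype.card α : ℕ) (f τ) U) {x : 𝕜} (hx : x ∈ U) :
    ∑ γ : α → S, ∏ τ, iteratedDeriv ((univ.filter fun j => γ j = τ).card) (f τ) x =
      iteratedDeriv (Fintype.card α) (fun s => ∏ τ, f τ s) x := by
  obtain ⟨s₀⟩ := ‹Nonempty S›
  have h := sum_asg_prod_iteratedDeriv s₀ hU (univ : Finset α) (by rwa [card_univ]) hx
  rwa [asg_univ, card_univ] at h

omit [Fintype α] [DecidableEq α] in
/-- **p25's shape on an open set**: with `BIJ88Expansion5143Gauss.mult γ τ` (`γ : Fin n → S`) and factors `Cⁿ` on an open `U ∋ x`,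
`(Π_τ f_τ)^{(n)}(x) = Σ_{γ : Fin n → S} Π_τ f_τ^{(mult γ τ)}(x)` — the local version of `BIJ88Expansion5143Gauss.iteratedDeriv_prod_eq_sum_assignments`
(there: all iterated derivatives differentiable on the whole line). [cite: BalabanImbrieJaffe1988, (5.14.2) p.308] -/
theorem iteratedDeriv_prod_eq_sum_mult_of_isOpen [Nonempty S] {U : Set ℝ} (hU : IsOpen U) {f : S → ℝ → ℝ} (n : ℕ)
    (hf : ∀ τ, ContDiffOn ℝ n (f τ) U) {x : ℝ} (hx : x ∈ U) :
    iteratedDeriv n (fun s => ∏ τ, f τ s) x = ∑ γ : Fin n → S, ∏ τ, iteratedDeriv (BIJ88Expansion5143Gauss.mult γ τ) (f τ) x := by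
  have h := sum_prod_iteratedDeriv_eq (α := Fin n) hU (f := f) (by rwa [Fintype.card_fin]) hx
  rw [Fintype.card_fin] at h
  exact h.symm

end Calculus

/-! ## §3 Slot-locality of the truncated functions from slot-locality of the moments -/

section Locality

variable {α : Type*} [Fintype α] [DecidableEq α] {S : Type*} [Fintype S]

omit [Fintype α] [Fintype S] in
/-- **Locality of the display-2 truncations from locality of the moments.** If the slot moments `N(K,γ)` (`K ⊆ H`) depend on the assignment
`γ` only through `γ|_K`, and for every `γ` the family `κ(·,γ)` solves p. 310 display 2 `N(K,γ) = Σ_{π∈𝒫(K)} Π_{A∈π} κ(A,γ)` (`∅ ≠ K ⊆ H`),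
then `κ(A,γ)` depends on `γ` only through `γ|_A` (`∅ ≠ A ⊆ H`): two assignments agreeing on `A` give two solutions of display 2 against the
same moments on the subsets of `A` (`BIJ88TruncatedExpectation5142.trunc_unique`). [cite: BalabanImbrieJaffe1988, p.310 display 2] -/
theorem trunc_local_of_moment_local {R : Type*} [CommRing R] {H : Finset α} {N κ : Finset α → (α → S) → R}
    (hNloc : ∀ K ⊆ H, ∀ γ γ', (∀ j ∈ K, γ j = γ' j) → N K γ = N K γ')
    (hrel : ∀ γ, ∀ K ⊆ H, K.Nonempty → N K γ = ∑ π ∈ setPartitions K, ∏ A ∈ π, κ A γ) :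
    ∀ A ⊆ H, A.Nonempty → ∀ γ γ', (∀ j ∈ A, γ j = γ' j) → κ A γ = κ A γ' := by
  intro A hAH hA γ γ' hγ
  refine trunc_unique (V := A) (m := fun K => N K γ) (κ₁ := fun K => κ K γ) (κ₂ := fun K => κ K γ')
    (fun K hKA hK => hrel γ K (hKA.trans hAH) hK) (fun K hKA hK => ?_) A Subset.rfl hA
  rw [hNloc K (hKA.trans hAH) γ γ' fun j hj => hγ j (hKA hj)]
  exact hrel γ' K (hKA.trans hAH) hK

/-- `…5142Slots.sum_asg_trunc_rel` with the locality of the truncations DERIVED from that of the moments: the assignment sums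
`Σ_{γ∈asg K} N(K,γ)` and `Σ_{γ∈asg A} κ(A,γ)` again satisfy display 2 (`∅ ≠ K ⊆ H`). [cite: BalabanImbrieJaffe1988, p.310 display 2] -/
theorem sum_asg_trunc_rel_of_moment_local {R : Type*} [CommRing R] {s₀ : S} {H : Finset α}
    {N κ : Finset α → (α → S) → R}
    (hNloc : ∀ K ⊆ H, ∀ γ γ', (∀ j ∈ K, γ j = γ' j) → N K γ = N K γ')
    (hrel : ∀ γ, ∀ K ⊆ H, K.Nonempty → N K γ = ∑ π ∈ setPartitions K, ∏ A ∈ π, κ A γ) :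
    ∀ K ⊆ H, K.Nonempty →
      ∑ γ ∈ asg s₀ K, N K γ = ∑ π ∈ setPartitions K, ∏ A ∈ π, ∑ γ ∈ asg s₀ A, κ A γ := by
  intro K hKH hK
  rw [sum_congr rfl fun γ _ => hrel γ K hKH hK, sum_comm]
  refine sum_congr rfl fun π hπ => sum_asg_prod_eq_prod_sum (mem_setPartitions.1 hπ) fun A hA => ?_
  have hP := mem_setPartitions.1 hπ
  exact trunc_local_of_moment_local hNloc hrel A ((hP.subset hA).trans hKH) (hP.nonempty_of_mem hA)

/-- **`Σ_γ ⟨(d/dt)_{γ_1}; …; (d/dt)_{γ_{|K|}}⟩_t = (d/dt)^{|K|} log z_t` with ONLY moment-side hypotheses**: slot moments `N(K,γ)` local in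
`γ|_K` and summing over `asg s₀ K` to the derivative moments `z^{(|K|)}(t)/z(t)` (`z > 0` of class `Cⁿ` within `s ∋ t`, `|H| ≤ n`), `κ(·,γ)`
ANY solution of display 2 against `N(·,γ)` (`∅ ≠ K ⊆ H`) — then `Σ_{γ ∈ asg s₀ K} κ(K,γ) = (log z)^{(|K|)}(t)`
(`…5142Slots.sum_asg_trunc_eq_iteratedDerivWithin_log` without its `hκloc`). [cite: BalabanImbrieJaffe1988, (5.14.2) p.308; p.310 display 2] -/
theorem sum_asg_trunc_eq_iteratedDerivWithin_log_of_moment_local {s : Set ℝ} (hs : UniqueDiffOn ℝ s) {t : ℝ}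
    (ht : t ∈ s) {z : ℝ → ℝ} {n : ℕ} (hz : ContDiffOn ℝ n z s) (hpos : ∀ x ∈ s, 0 < z x) {H : Finset α}
    (hH : H.card ≤ n) {s₀ : S} {N κ : Finset α → (α → S) → ℝ}
    (hNloc : ∀ K ⊆ H, ∀ γ γ', (∀ j ∈ K, γ j = γ' j) → N K γ = N K γ')
    (hrel : ∀ γ, ∀ K ⊆ H, K.Nonempty → N K γ = ∑ π ∈ setPartitions K, ∏ A ∈ π, κ A γ)
    (hN : ∀ K ⊆ H, K.Nonempty → ∑ γ ∈ asg s₀ K, N K γ = iteratedDerivWithin K.card z s t / z t) :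
    ∀ K ⊆ H, K.Nonempty → ∑ γ ∈ asg s₀ K, κ K γ = iteratedDerivWithin K.card (fun x => Real.log (z x)) s t := by
  refine trunc_eq_iteratedDerivWithin_log hs ht hz hpos hH (κ := fun A => ∑ γ ∈ asg s₀ A, κ A γ) fun K hKH hK => ?_
  rw [← hN K hKH hK]
  exact sum_asg_trunc_rel_of_moment_local hNloc hrel K hKH hK

end Locality

end Literature.MathematicalPhysics.QuantumFieldTheory.BalabanImbrieJaffe1984to88.BIJ88SlotLeibniz308
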